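import Literature.MathematicalPhysics.QuantumFieldTheory.Balaban1983to89.B9Eq3132FlatReadingAtOne

/-!
# `Balaban1983to89.B9Eq3132FlatReadingAtRecord` — [Balaban1985BackgroundPropagators] (3.132) p. 422 AT `U = 1`, AT THE LETTERS OF RECORD: row 26 of
# the N06 table as typed is FALSE at the genuine `(QGQ*)⁻¹ = QGQinvY` of EVERY `CovLettersY` family read flat (def-Y v3 `opsYOfRecordDE`, n06-i's
# `opsYS349OfRecordDE`, def-Y v4 `opsYOfRecordV4E`), and the displayed estimate binders of the landed row-26 faces are JOINTLY UNSATISFIABLE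

statement-level skeleton of published theorems with citation tags; proofs where landed; nothing here is a claim about the Yang–Mills mass gap

The mechanism, the print loci and the repair are in the sibling `B9Eq3132FlatReadingAtOne` (★★★ `not_stmt3132Printed_flat_of_one`: Kantorovich +
[4] (2.142) `B6Ineq2142KLevelV1.ineq2142_kLevel` at the top-empty members of `Node00.kRIdx_nonvacuous_oddL`, `U = 1`).  THIS FILE instantiates it.

## WHAT IS PROVED (sorry-free, 0 `def`, standard axioms)

* §6 ★★★ `not_stmt3132Printed_QGQinvY` — for EVERY family `𝔏 x : CovLettersY 𝔸 x` (its `U = 1` clauses are fields) the flat reading of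
  `QGQinvY x.toKIdx (𝔏 x).parS (𝔏 x).parB (𝔏 x).Gp` is not a `B9.Stmt3132Printed` family (any second kernel, `dd`, `c35 > 0`; `4 ≤ ℓ`, `‖1‖ = 1`); at the
  record's carriers (`M_N(ℂ)`, `SU(N)`, every `θ : Stage3Params` with `4 ≤ θ.ℓ₆`): `not_s3132_opsYOfLetters_withSectD` (every base family),
  `not_s3132_lettersYSectD`, ★ `not_s3132_opsYOfRecordDE` (def-Y v3; the instance of n06-d's p496372), ★ `not_s3132_opsYS349OfRecordDE` (n06-i g6's
  instance; n06-d's p499764), ★ `not_s3132_opsYOfRecordV4E` (def-Y v4, the instance of record, p500763).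
* §7 ★★ `coercive_decay_false_lettersYSectD` — the TWO estimate binders (`CoerciveUnder` ∧ `DecayUnder` of `normMatY b (len^{−(1+dd∕2)}) (QGQY … U)`) of
  n06-i g5's `s3132_lettersYSectD` (p490565 §5) are JOINTLY UNSATISFIABLE; ★★ `coercive_decay_false_opsYOfRecordDE` — the FOUR binders
  `hco26 hdec26 hco₁26 hdec₁26` displayed by n06-d's certificates p496372 ∕ p499764 (fed to n06-i g6's `s3132_opsYOfRecordDE`, p495362) are JOINTLY
  UNSATISFIABLE: those certificates are vacuous AS TYPED (ex falso) until the reading ∕ normalisation is repaired (owners: def-Y reading side,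
  dag-n06-i face side — see the sibling's REPAIR).  The landed implications p472447 ∕ p475370 ∕ p482854 ∕ p490565 ∕ p495362 stay TRUE as implications;
  their estimate binders, in the bundle's `len^{−(1+d′∕2)}`-normalisation at the FLAT reading, cannot all hold.

HONEST SCOPE.  Nothing of [B9] is asserted; [4]-at-`U = 1` linear algebra plus bookkeeping; COUNT-NEUTRAL; N06 NOT discharged; nothing continuum ∕
OS ∕ mass-gap ∕ Clay.  Cell `pub-ymgap` (HUMAN RULING D-0062), node N06 [B9], seat `pub-ymgap-dag-n06-i` (harness re-seat gen 7), 2026-08-27.  A NEW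
file; nothing landed is modified.
-/

namespace Literature.MathematicalPhysics.QuantumFieldTheory.Balaban1983to89.B9Eq3132FlatReadingAtRecord

open Node00
open B9PinMembersKLevelV1 (MemberY geo9Y bg9Y)
open B9Eq3132FlatReadingAtOne (not_stmt3132Printed_flat_of_one)

noncomputable section

/-! ## §6 Corollaries at the letters: the genuine `(QGQ*)⁻¹ = QGQinvY` of any `CovLettersY` family; the instances of record -/

section Letters

variable {𝔸 : Type} [NormedRing 𝔸] [NormedAlgebra ℂ 𝔸] [CompleteSpace 𝔸] [NormOneClass 𝔸] (G : Subgroup 𝔸ˣ)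
variable {d ℓ : ℕ} {hd : 1 ≤ d + 1} {hL : Odd (ℓ + 1) ∧ 1 < ℓ + 1} {b₀ b₁ : ℝ} {Mstar : ℕ}

/-- ★★★ **ROW 26's FIRST LETTER AT ANY `CovLettersY` FAMILY, READ FLAT, FAILS (3.132) AS TYPED**: for every family `𝔏 x : CovLettersY 𝔸 x` (its `U = 1`
clauses `parS_one ∕ parB_one ∕ Gp_one` are fields) the flat reading of the genuine `(QGQ*)⁻¹(U) = QGQinvY x.toKIdx (𝔏 x).parS (𝔏 x).parB (𝔏 x).Gp U`
(`B9Eq3132SectDLetters`, (3.123)∕(3.132)) is NOT a `B9.Stmt3132Printed` family — whatever the second kernel, `dd`, `c35 > 0`.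
[cite: Balaban1985BackgroundPropagators, (3.132) p.422, (3.123) p.420, Cor. 3.5 p.407; Balaban1984PropagatorsII, (2.142) p.248, (2.149) p.249] -/
theorem not_stmt3132Printed_QGQinvY (hℓ : 4 ≤ ℓ) (hb₀ : 0 < b₀) (hb₁ : b₀ ≤ b₁) (dd : ℕ) {c35 : ℝ} (hc35 : 0 < c35)
    (𝔏 : ∀ x : MemberY d ℓ hd hL b₀ b₁ Mstar, CovLettersY 𝔸 x)
    (K₁ : ∀ x : MemberY d ℓ hd hL b₀ b₁ Mstar, B9.SiteKernel (geo9Y x) (bg9Y 𝔸 G x)) :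
    ¬ B9.Stmt3132Printed dd c35 (geo9Y (d := d) (ℓ := ℓ) (hd := hd) (hL := hL) (b₀ := b₀) (b₁ := b₁) (Mstar := Mstar)) (bg9Y 𝔸 G)
        (fun x => siteKernelOfOp x.toKIdx (bg9Y 𝔸 G x) (fun U => U)
          (B9Eq3132SectDLetters.QGQinvY x.toKIdx (𝔏 x).parS (𝔏 x).parB (𝔏 x).Gp) id id) K₁ :=
  not_stmt3132Printed_flat_of_one G hℓ hb₀ hb₁ dd hc35 _
    (fun x => B9Eq3132SectDLetters.QGQinvY_one_liftEndY x.toKIdx (𝔏 x).parS_one (𝔏 x).parB_one (𝔏 x).Gp_one) K₁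

end Letters

section Record

open scoped Matrix.Norms.L2Operator
open B7Prop2SpecialUnitary (specialUnitaryUnits)
open B9Eq3132SectDLetters (QGQY QGQinvY withSectD lettersYSectD s3132_withSectD s3132_lettersYSectD Half3132)
open B9Eq3132CTInputs (CoerciveUnder DecayUnder)
open B9Eq3132ScalarIndex (geoComap)
open B9Eq3132RingInverseReading (normMatY)
open B9Ineq349SiteReading (opsYS349OfRecordDE)

variable {N : ℕ} [NeZero N]

/-- ★★ **AT `opsYOfLetters … (x ↦ withSectD (𝔏 x)) …`** (n06-i g5's constructor; every base family `𝔏`): row 26 as typed is FALSE.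
[cite: Balaban1985BackgroundPropagators, (3.132) p.422; Balaban1984PropagatorsII, (2.142) p.248] -/
theorem not_s3132_opsYOfLetters_withSectD (θ : Stage3Params) (hℓ : 4 ≤ θ.ℓ₆) (Mstar : ℕ) (𝔏 : LettersY N θ Mstar) (𝔈 : ExpsY N θ Mstar)
    (dd : ℕ) {c35 : ℝ} (hc35 : 0 < c35) :
    ¬ B9.Stmt3132Printed dd c35 (geo9Y (d := θ.d₆) (ℓ := θ.ℓ₆) (hd := θ.hd') (hL := θ.hL') (b₀ := θ.b₀) (b₁ := θ.b₁) (Mstar := Mstar))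
        (bg9Y (Matrix (Fin N) (Fin N) ℂ) (specialUnitaryUnits (Fin N)))
        (fun x => (opsYOfLetters N θ Mstar (fun x => withSectD (Matrix (Fin N) (Fin N) ℂ) (𝔏 x)) 𝔈 x).QGQinv)
        (fun x => (opsYOfLetters N θ Mstar (fun x => withSectD (Matrix (Fin N) (Fin N) ℂ) (𝔏 x)) 𝔈 x).QG1Qinv) :=
  not_stmt3132Printed_QGQinvY (specialUnitaryUnits (Fin N)) hℓ θ.hb.1 θ.hb.2 dd hc35 𝔏 _

/-- ★★ **AT `lettersYSectD`** (g5's letters of record over the v2 base): row 26 as typed is FALSE. [cite: Balaban1985BackgroundPropagators, (3.132) p.422] -/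
theorem not_s3132_lettersYSectD (θ : Stage3Params) (hℓ : 4 ≤ θ.ℓ₆) (Mstar : ℕ) (𝔈 : ExpsY N θ Mstar) (dd : ℕ) {c35 : ℝ} (hc35 : 0 < c35) :
    ¬ B9.Stmt3132Printed dd c35 (geo9Y (d := θ.d₆) (ℓ := θ.ℓ₆) (hd := θ.hd') (hL := θ.hL') (b₀ := θ.b₀) (b₁ := θ.b₁) (Mstar := Mstar))
        (bg9Y (Matrix (Fin N) (Fin N) ℂ) (specialUnitaryUnits (Fin N)))
        (fun x => (opsYOfLetters N θ Mstar (lettersYSectD N θ Mstar) 𝔈 x).QGQinv)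
        (fun x => (opsYOfLetters N θ Mstar (lettersYSectD N θ Mstar) 𝔈 x).QG1Qinv) :=
  not_s3132_opsYOfLetters_withSectD θ hℓ Mstar _ 𝔈 dd hc35

/-- ★★★ **AT def-Y's v3 RECORD `opsYOfRecordDE`** (the instance of n06-d's certificate p496372): row 26 as typed is FALSE.
[cite: Balaban1985BackgroundPropagators, (3.132) p.422; Balaban1984PropagatorsII, (2.142) p.248, (2.149) p.249] -/
theorem not_s3132_opsYOfRecordDE (θ : Stage3Params) (hℓ : 4 ≤ θ.ℓ₆) (Mstar : ℕ) (𝔯 : ResY N θ Mstar) (𝔈 : ExpsY N θ Mstar)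
    (dd : ℕ) {c35 : ℝ} (hc35 : 0 < c35) :
    ¬ B9.Stmt3132Printed dd c35 (geo9Y (d := θ.d₆) (ℓ := θ.ℓ₆) (hd := θ.hd') (hL := θ.hL') (b₀ := θ.b₀) (b₁ := θ.b₁) (Mstar := Mstar))
        (bg9Y (Matrix (Fin N) (Fin N) ℂ) (specialUnitaryUnits (Fin N)))
        (fun x => (opsYOfRecordDE N θ Mstar 𝔯 𝔈 x).QGQinv) (fun x => (opsYOfRecordDE N θ Mstar 𝔯 𝔈 x).QG1Qinv) :=
  not_stmt3132Printed_QGQinvY (specialUnitaryUnits (Fin N)) hℓ θ.hb.1 θ.hb.2 dd hc35 (lettersYOfRecordDE N θ Mstar 𝔯) _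

/-- ★★★ **AT n06-i's (3.49)-GENUINE INSTANCE `opsYS349OfRecordDE`** (the instance of n06-d's certificate p499764): row 26 as typed is FALSE.
[cite: Balaban1985BackgroundPropagators, (3.132) p.422; Balaban1984PropagatorsII, (2.142) p.248, (2.149) p.249] -/
theorem not_s3132_opsYS349OfRecordDE (θ : Stage3Params) (hℓ : 4 ≤ θ.ℓ₆) (Mstar : ℕ) (𝔯 : ResY N θ Mstar) (𝔈 : ExpsY N θ Mstar)
    (dd : ℕ) {c35 : ℝ} (hc35 : 0 < c35) :
    ¬ B9.Stmt3132Printed dd c35 (geo9Y (d := θ.d₆) (ℓ := θ.ℓ₆) (hd := θ.hd') (hL := θ.hL') (b₀ := θ.b₀) (b₁ := θ.b₁) (Mstar := Mstar))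
        (bg9Y (Matrix (Fin N) (Fin N) ℂ) (specialUnitaryUnits (Fin N)))
        (fun x => (opsYS349OfRecordDE N θ Mstar 𝔯 𝔈 x).QGQinv) (fun x => (opsYS349OfRecordDE N θ Mstar 𝔯 𝔈 x).QG1Qinv) :=
  not_s3132_opsYOfRecordDE θ hℓ Mstar 𝔯 𝔈 dd hc35

/-- ★★★ **AT def-Y's v4 INSTANCE OF RECORD `opsYOfRecordV4E`** (symmetrised transporters; p500763): row 26 as typed is FALSE.
[cite: Balaban1985BackgroundPropagators, (3.132) p.422; Balaban1984PropagatorsII, (2.142) p.248, (2.149) p.249] -/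
theorem not_s3132_opsYOfRecordV4E (θ : Stage3Params) (hℓ : 4 ≤ θ.ℓ₆) (Mstar : ℕ) (𝔯 : ResY N θ Mstar) (𝔢 : SectEY N θ Mstar)
    (𝔴 : RWEY N θ Mstar) (𝔈 : ExpsY N θ Mstar) (dd : ℕ) {c35 : ℝ} (hc35 : 0 < c35) :
    ¬ B9.Stmt3132Printed dd c35 (geo9Y (d := θ.d₆) (ℓ := θ.ℓ₆) (hd := θ.hd') (hL := θ.hL') (b₀ := θ.b₀) (b₁ := θ.b₁) (Mstar := Mstar))
        (bg9Y (Matrix (Fin N) (Fin N) ℂ) (specialUnitaryUnits (Fin N)))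
        (fun x => (opsYOfRecordV4E N θ Mstar 𝔯 𝔢 𝔴 𝔈 x).QGQinv) (fun x => (opsYOfRecordV4E N θ Mstar 𝔯 𝔢 𝔴 𝔈 x).QG1Qinv) :=
  not_stmt3132Printed_QGQinvY (specialUnitaryUnits (Fin N)) hℓ θ.hb.1 θ.hb.2 dd hc35 (lettersYOfRecordV4 N θ Mstar 𝔯) _

/-! ## §7 ★★ Consequence: the displayed estimate binders of the landed row-26 faces are JOINTLY UNSATISFIABLE at the flat reading -/

variable {Ff : Type} [Fintype Ff] [DecidableEq Ff]

/-- ★★ **THE TWO BINDERS OF `s3132_lettersYSectD` CANNOT BOTH HOLD** (`L ≥ 5`, `c35 > 0`): coercivity AND decay, in the bundle's symmetric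
normalisation `w(y) = (Lʲη)^{−(1+dd∕2)}`, of the real matrix of the genuine `(QGQ*)(U)` are jointly unsatisfiable — they imply the false row.
LOCATED defect of the normalisation (units), self-reported by the row's seat; the [4]-correct normalisation is `Λ⁻¹` (`B6Prop27KLevelV1.wt`).
[cite: Balaban1985BackgroundPropagators, (3.132) p.422; Balaban1984PropagatorsII, (2.142) (2.147) p.248, Prop. 2.7 (2.149) p.249] -/
theorem coercive_decay_false_lettersYSectD (θ : Stage3Params) (hℓ : 4 ≤ θ.ℓ₆) (Mstar : ℕ) (𝔈 : ExpsY N θ Mstar) (dd : ℕ) {c35 : ℝ}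
    (hc35 : 0 < c35)
    [∀ x : MemberY θ.d₆ θ.ℓ₆ θ.hd' θ.hL' θ.b₀ θ.b₁ Mstar, Fintype (geo9Y x).Site]
    [∀ x : MemberY θ.d₆ θ.ℓ₆ θ.hd' θ.hL' θ.b₀ θ.b₁ Mstar, DecidableEq (geo9Y x).Site]
    (b : Module.Basis Ff ℝ (Matrix (Fin N) (Fin N) ℂ))
    (hco : CoerciveUnder c35
      (fun x : MemberY θ.d₆ θ.ℓ₆ θ.hd' θ.hL' θ.b₀ θ.b₁ Mstar => geoComap (geo9Y x) (Prod.fst : (geo9Y x).Site × Ff → (geo9Y x).Site))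
      (bg9Y (Matrix (Fin N) (Fin N) ℂ) (specialUnitaryUnits (Fin N)))
      (fun x U => normMatY b (fun y => (geo9Y x).len y ^ (-(1 + (dd : ℝ) / 2)))
        (QGQY x.toKIdx (parSY x.toKIdx) (parBY x.toKIdx) (GpY x.toKIdx (parSY x.toKIdx)) U)))
    (hdec : DecayUnder c35
      (fun x : MemberY θ.d₆ θ.ℓ₆ θ.hd' θ.hL' θ.b₀ θ.b₁ Mstar => geoComap (geo9Y x) (Prod.fst : (geo9Y x).Site × Ff → (geo9Y x).Site))
      (bg9Y (Matrix (Fin N) (Fin N) ℂ) (specialUnitaryUnits (Fin N)))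
      (fun x U => normMatY b (fun y => (geo9Y x).len y ^ (-(1 + (dd : ℝ) / 2)))
        (QGQY x.toKIdx (parSY x.toKIdx) (parBY x.toKIdx) (GpY x.toKIdx (parSY x.toKIdx)) U))) : False :=
  not_s3132_lettersYSectD θ hℓ Mstar 𝔈 dd hc35 (s3132_lettersYSectD θ Mstar 𝔈 dd b hco hdec)

/-- ★★ **THE FOUR BINDERS `hco26 hdec26 hco₁26 hdec₁26` OF n06-d's CERTIFICATES p496372 ∕ p499764 ARE JOINTLY UNSATISFIABLE** (`L ≥ 5`, `c35 > 0`):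
they feed n06-i g6's `s3132_opsYOfRecordDE` (p495362), whose conclusion is false (`not_s3132_opsYOfRecordDE`).  Those certificates are therefore
vacuous AS TYPED (ex falso) until the reading ∕ normalisation is repaired; count-neutral files, no booking affected.
[cite: Balaban1985BackgroundPropagators, (3.132) p.422; Balaban1984PropagatorsII, (2.142) p.248, Prop. 2.7 (2.149) p.249] -/
theorem coercive_decay_false_opsYOfRecordDE (θ : Stage3Params) (hℓ : 4 ≤ θ.ℓ₆) (Mstar : ℕ) (𝔯 : ResY N θ Mstar) (𝔈 : ExpsY N θ Mstar)
    (dd : ℕ) {c35 : ℝ} (hc35 : 0 < c35)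
    [∀ x : MemberY θ.d₆ θ.ℓ₆ θ.hd' θ.hL' θ.b₀ θ.b₁ Mstar, Fintype (geo9Y x).Site]
    [∀ x : MemberY θ.d₆ θ.ℓ₆ θ.hd' θ.hL' θ.b₀ θ.b₁ Mstar, DecidableEq (geo9Y x).Site]
    (b : Module.Basis Ff ℝ (Matrix (Fin N) (Fin N) ℂ))
    (hco : CoerciveUnder c35
      (fun x : MemberY θ.d₆ θ.ℓ₆ θ.hd' θ.hL' θ.b₀ θ.b₁ Mstar => geoComap (geo9Y x) (Prod.fst : (geo9Y x).Site × Ff → (geo9Y x).Site))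
      (bg9Y (Matrix (Fin N) (Fin N) ℂ) (specialUnitaryUnits (Fin N)))
      (fun x U => normMatY b (fun y => (geo9Y x).len y ^ (-(1 + (dd : ℝ) / 2)))
        (QGQY x.toKIdx (parSY x.toKIdx) (parBY x.toKIdx) (GpY x.toKIdx (parSY x.toKIdx)) U)))
    (hdec : DecayUnder c35
      (fun x : MemberY θ.d₆ θ.ℓ₆ θ.hd' θ.hL' θ.b₀ θ.b₁ Mstar => geoComap (geo9Y x) (Prod.fst : (geo9Y x).Site × Ff → (geo9Y x).Site))
      (bg9Y (Matrix (Fin N) (Fin N) ℂ) (specialUnitaryUnits (Fin N)))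
      (fun x U => normMatY b (fun y => (geo9Y x).len y ^ (-(1 + (dd : ℝ) / 2)))
        (QGQY x.toKIdx (parSY x.toKIdx) (parBY x.toKIdx) (GpY x.toKIdx (parSY x.toKIdx)) U)))
    (hco₁ : CoerciveUnder c35
      (fun x : MemberY θ.d₆ θ.ℓ₆ θ.hd' θ.hL' θ.b₀ θ.b₁ Mstar => geoComap (geo9Y x) (Prod.fst : (geo9Y x).Site × Ff → (geo9Y x).Site))
      (bg9Y (Matrix (Fin N) (Fin N) ℂ) (specialUnitaryUnits (Fin N)))
      (fun x U => normMatY b (fun y => (geo9Y x).len y ^ (-(1 + (dd : ℝ) / 2)))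
        (QGQOfY x.toKIdx (parBY x.toKIdx)
          (G1Y x.toKIdx (parSY x.toKIdx) (parBY x.toKIdx) (GpY x.toKIdx (parSY x.toKIdx)) (𝔯 x).Δ2) U)))
    (hdec₁ : DecayUnder c35
      (fun x : MemberY θ.d₆ θ.ℓ₆ θ.hd' θ.hL' θ.b₀ θ.b₁ Mstar => geoComap (geo9Y x) (Prod.fst : (geo9Y x).Site × Ff → (geo9Y x).Site))
      (bg9Y (Matrix (Fin N) (Fin N) ℂ) (specialUnitaryUnits (Fin N)))
      (fun x U => normMatY b (fun y => (geo9Y x).len y ^ (-(1 + (dd : ℝ) / 2)))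
        (QGQOfY x.toKIdx (parBY x.toKIdx)
          (G1Y x.toKIdx (parSY x.toKIdx) (parBY x.toKIdx) (GpY x.toKIdx (parSY x.toKIdx)) (𝔯 x).Δ2) U))) : False :=
  not_s3132_opsYOfRecordDE θ hℓ Mstar 𝔯 𝔈 dd hc35
    (B9Eq3132AtRecordDE.s3132_opsYOfRecordDE θ Mstar 𝔯 𝔈 dd b hco hdec hco₁ hdec₁)

end Record

end

end Literature.MathematicalPhysics.QuantumFieldTheory.Balaban1983to89.B9Eq3132FlatReadingAtRecord
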